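import Summits.QuantumFields.BalabanUV.T4Continuum.Support.NE3QuadRemainderLocalBox
import HarnessLib

/-!
# T⁴ programme, node NE3 — route Π, THE LEAF OF RECORD FOR Π-C-3γ″ (ruling ρ-g26-1 (2); design D-ne3leaf02g8-1 §4 «Γ″»; NE3-R2 g12's D-12-1∕D-12-4):
# (Π-REG-γ″) «GAUGED TWO-TIER MAJORANT» — the relative field `X₀` of a pair is a SMOOTH COMPANION `B` (box-sup majorant `m`, square-summable)
# RE-GAUGED by `u = e^{λ}` whose potential has a constant level `ℓ` plus corner SPIKES of amplitude `Λ` with a fixed lattice profile `prof`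

NE3 (node U1b) formalisation swarm `b2b-balaban-t4-ne3-formalise-*`, LEAF PROVER 02 (gen 8; Π-C authors' lineage; binder fixed by this seat per ρ-g26-1 (2)).

WHY THIS SHAPE (D-ne3r2-g12-1: for the residual slice representative the old SUP majorant `LocalSupMajorant[Ball]` is NOT k-free — the pinned Landau gauge adds
a lattice-Coulomb spike ∝ L^k at every top corner; D-12-4: after removing `a_z·(1+r∕2)^{1−d}` at the corners the residual is the UNPINNED bulk, k-free, and
`a_z∕L^k ≈ 0.2–0.9·rms`).  The spike is a GAUGE artefact: `X₀ = log(W⁻¹·(W e^{B})^{u})` with `B` the smooth (unpinned-gauge) relative field and `u = e^{λ}`,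
`λ = −Σ_z g_z h_z` the pinned-minus-unpinned potentials (lattice Green's functions).  The kernel (γ-top `NE3QuadRemainderGauged`, γ4″, γ-END) carries `u`
EXACTLY through the k-fold average, so the leaf only has to say: (E) the gauge relation, (T1) `B` has a box-sup majorant, (T2) `λ` is a constant level plus
profile-shaped spikes at finitely many corner points, (T3) all tiers square-summable against `dirSq X₀`.  The profile `prof` and the corner sets `S` are
PARAMETERS (γ4″ fixes `prof`; the provider fixes `S`, `|S| ≤ 3·2^d`).

CONTENT (definition lane; 0 sorry): `GaugedTwoTierData` (the clauses for given `(λ, B)`), **`GaugedTwoTier`** (∃ (λ, B) + the square-summability), projections,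
and `gaugedTwoTier_of_zero` (NON-VACUITY at `X₀ = 0`: `λ = 0`, `B = 0`, all tiers zero).

HONEST FRAMING.  A hypothesis SHAPE asserted here only for the zero datum; for a minimiser pair it is B11 Thm 1∕Prop 2 regularity TYPE («the constrained
minimiser is smooth at the unit scale in the unpinned Landau gauge; the slice's pinning is a superposition of lattice Coulomb potentials») — ours in form,
printed nowhere; its k-freeness for the pair is NE3-R2 g12's engine evidence (D-12-4), not a theorem.  Π-C-3γ″, T-E_w♯ and NE3 are NOT proved; spine PROVED
0∕9; finite T⁴ rung (B)+1 — NOT infinite volume, NOT mass gap, NOT `BetaPertH`, NOT Clay.  ABSOLUTE RULE kept (no printed sentence is a hypothesis).  PLACEMENT: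
`Summits/QuantumFields/BalabanUV/`.  HONEST DEPENDENCY: continuum YM on T⁴ ⇐ BetaPertH ∧ nine spine estimates (0/9 proved); BetaPertH ⇐ (D1) ∧ (D4) ∧ CAP+tail;
G-an2-4 gates asym, D1 and NE2/3/4.
-/

set_option autoImplicit false

open scoped BigOperators Matrix.Norms.L2Operator
open NormedSpace Finset

namespace Summit.QuantumFields.BalabanUV.T4Continuum.NE3GaugedTwoTierShape

open Literature.MathematicalPhysics.QuantumFieldTheory.Balaban1983to89
open B7Prop1Explicit B7Prop2Explicit MatrixLog
open B7Prop1Local (InBox loK bondHiK)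
open T4AveragingDeficitWall (IsSkewDir vary dirSq)
open T4AveragingDeficitWallBoundary (periodBox)
open AveragingDeficitPeriodicCounting (IsPeriodicDir)
open BlockAveragePushDirGauge (gaugeDir expGauge)

noncomputable section

variable {d : ℕ} {n : Type*} [Fintype n] [DecidableEq n]

/-! ## §1 The clauses for given gauge data `(λ, B)` -/

/-- **THE CLAUSES OF (Π-REG-γ″) FOR GIVEN GAUGE DATA** `(λ, B)` at level `k` (period `N·L^k`), profile `prof`, corner sets `S z κ`, tiers `m` (companion
sup), `ℓ` (potential level), `Λ` (spike amplitude): skew∕periodic∕small data, the EXACT gauge relation `W·e^{X₀} = (W·e^{B})^{e^{λ}}`, and the two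
box-local dominations. [folklore] -/
@[folklore]
structure GaugedTwoTierData (L N k : ℕ) (W : Site d → Fin d → (Matrix n n ℂ)ˣ) (X₀ : Site d → Fin d → Matrix n n ℂ) (prof : Site d → ℝ)
    (S : Site d → Fin d → Finset (Site d)) (lam : Site d → Matrix n n ℂ) (B : Site d → Fin d → Matrix n n ℂ)
    (m ℓ Λ : Site d → Fin d → ℝ) : Prop where
  /-- the charges are skew -/
  lam_skew : ∀ y : Site d, lam y ∈ skewAdjoint (Matrix n n ℂ)
  /-- the charges are `N·L^k`-periodic -/
  lam_per : ∀ (y : Site d) (i : Fin d), lam (y + ((L ^ k * N : ℕ) : ℤ) • e i) = lam y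
  /-- the charges are in the BCH ball -/
  lam_small : ∀ y : Site d, ‖lam y‖ ≤ 1 / 8192
  /-- the companion is skew -/
  B_skew : IsSkewDir B
  /-- the companion is `N·L^k`-periodic -/
  B_per : IsPeriodicDir B ((L ^ k * N : ℕ) : ℤ)
  /-- the companion is in the BCH ball -/
  B_small : ∀ (y : Site d) (μ : Fin d), ‖B y μ‖ ≤ 1 / 8192
  /-- (E) THE GAUGE RELATION: `W·e^{X₀} = (W·e^{B})^{e^{λ}}` as configurations -/
  gauge_eq : vary W X₀ 1 = gaugeAct (expGauge lam 1) (vary W B 1)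
  /-- (T1) the companion's box-sup majorant -/
  dom_B : ∀ (z : Site d) (κ : Fin d) (y : Site d) (μ : Fin d), InBox (loK L k z) (bondHiK L k z κ) y →
    InBox (loK L k z) (bondHiK L k z κ) (y + e μ) → ‖B y μ‖ ≤ m z κ
  /-- (T2) the potential: a constant level plus profile-shaped spikes at the corner points of the box -/
  dom_lam : ∀ (z : Site d) (κ : Fin d) (y : Site d), InBox (loK L k z) (bondHiK L k z κ) y →
    ‖lam y‖ ≤ ℓ z κ + Λ z κ * ∑ c ∈ S z κ, prof (y - c)

/-! ## §2 The leaf -/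

/-- **(Π-REG-γ″) «GAUGED TWO-TIER MAJORANT»** at level `k`: non-negative tiers `m`, `ℓ`, `Λ`, corner sets of bounded size, SOME gauge data `(λ, B)` obeying
`GaugedTwoTierData`, and SQUARE-SUMMABILITY of the three tiers in their currencies (`m`, `ℓ`, `Λ∕L^k`) against `dirSq X₀` with constant `C`.  A hypothesis
SHAPE (B11 Thm 1∕Prop 2 regularity TYPE in the unpinned Landau gauge + the Coulomb structure of the pinning; ours in form). [folklore] -/
@[folklore]
def GaugedTwoTier (L N k : ℕ) (W : Site d → Fin d → (Matrix n n ℂ)ˣ) (X₀ : Site d → Fin d → Matrix n n ℂ) (prof : Site d → ℝ)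
    (S : Site d → Fin d → Finset (Site d)) (m ℓ Λ : Site d → Fin d → ℝ) (C : ℝ) : Prop :=
  (∀ z κ, 0 ≤ m z κ) ∧ (∀ z κ, 0 ≤ ℓ z κ) ∧ (∀ z κ, 0 ≤ Λ z κ) ∧ (∀ z κ, (S z κ).card ≤ 3 * 2 ^ d) ∧ 0 ≤ C ∧
  (∃ (lam : Site d → Matrix n n ℂ) (B : Site d → Fin d → Matrix n n ℂ), GaugedTwoTierData L N k W X₀ prof S lam B m ℓ Λ) ∧
  ((L : ℝ) ^ k) ^ d * ∑ z ∈ periodBox (d := d) N, ∑ κ : Fin d, (m z κ ^ 2 + ℓ z κ ^ 2 + (Λ z κ / (L : ℝ) ^ k) ^ 2)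
    ≤ C ^ 2 * dirSq X₀ (periodBox (d := d) (N * L ^ k))

/-- Projection: the tiers are non-negative and the corner sets bounded. [folklore] -/
theorem GaugedTwoTier.nonneg {L N k : ℕ} {W : Site d → Fin d → (Matrix n n ℂ)ˣ} {X₀ : Site d → Fin d → Matrix n n ℂ} {prof : Site d → ℝ}
    {S : Site d → Fin d → Finset (Site d)} {m ℓ Λ : Site d → Fin d → ℝ} {C : ℝ} (h : GaugedTwoTier L N k W X₀ prof S m ℓ Λ C) (z : Site d) (κ : Fin d) :
    0 ≤ m z κ ∧ 0 ≤ ℓ z κ ∧ 0 ≤ Λ z κ ∧ (S z κ).card ≤ 3 * 2 ^ d ∧ 0 ≤ C :=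
  ⟨h.1 z κ, h.2.1 z κ, h.2.2.1 z κ, h.2.2.2.1 z κ, h.2.2.2.2.1⟩

/-- Projection: the gauge data. [folklore] -/
theorem GaugedTwoTier.data {L N k : ℕ} {W : Site d → Fin d → (Matrix n n ℂ)ˣ} {X₀ : Site d → Fin d → Matrix n n ℂ} {prof : Site d → ℝ}
    {S : Site d → Fin d → Finset (Site d)} {m ℓ Λ : Site d → Fin d → ℝ} {C : ℝ} (h : GaugedTwoTier L N k W X₀ prof S m ℓ Λ C) :
    ∃ (lam : Site d → Matrix n n ℂ) (B : Site d → Fin d → Matrix n n ℂ), GaugedTwoTierData L N k W X₀ prof S lam B m ℓ Λ :=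
  h.2.2.2.2.2.1

/-- Projection: square-summability. [folklore] -/
theorem GaugedTwoTier.sq {L N k : ℕ} {W : Site d → Fin d → (Matrix n n ℂ)ˣ} {X₀ : Site d → Fin d → Matrix n n ℂ} {prof : Site d → ℝ}
    {S : Site d → Fin d → Finset (Site d)} {m ℓ Λ : Site d → Fin d → ℝ} {C : ℝ} (h : GaugedTwoTier L N k W X₀ prof S m ℓ Λ C) :
    ((L : ℝ) ^ k) ^ d * ∑ z ∈ periodBox (d := d) N, ∑ κ : Fin d, (m z κ ^ 2 + ℓ z κ ^ 2 + (Λ z κ / (L : ℝ) ^ k) ^ 2)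
      ≤ C ^ 2 * dirSq X₀ (periodBox (d := d) (N * L ^ k)) :=
  h.2.2.2.2.2.2

/-! ## §3 Non-vacuity at the zero datum -/

/-- The zero gauge data satisfy the clauses for `X₀ = 0` with all tiers zero. [folklore] -/
theorem gaugedTwoTierData_zero [Nonempty n] (L N k : ℕ) (W : Site d → Fin d → (Matrix n n ℂ)ˣ) (prof : Site d → ℝ)
    (S : Site d → Fin d → Finset (Site d)) :
    GaugedTwoTierData L N k W (fun _ _ => 0) prof S (fun _ => 0) (fun _ _ => 0) (fun _ _ => 0) (fun _ _ => 0) (fun _ _ => 0) where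
  lam_skew _ := (skewAdjoint _).zero_mem
  lam_per _ _ := rfl
  lam_small _ := by rw [norm_zero]; norm_num
  B_skew _ _ := (skewAdjoint _).zero_mem
  B_per _ _ _ := rfl
  B_small _ _ := by rw [norm_zero]; norm_num
  gauge_eq := by
    funext y μ
    apply Units.ext
    simp [vary, gaugeAct, expGauge]
  dom_B _ _ _ _ _ _ := by rw [norm_zero]
  dom_lam _ _ _ _ := by rw [norm_zero, zero_mul, add_zero]

/-- **NON-VACUITY**: `GaugedTwoTier L N k W 0 prof (fun _ _ => ∅) 0 0 0 0`. [folklore] -/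
theorem gaugedTwoTier_of_zero [Nonempty n] (L N k : ℕ) (W : Site d → Fin d → (Matrix n n ℂ)ˣ) (prof : Site d → ℝ) :
    GaugedTwoTier L N k W (fun _ _ => 0) prof (fun _ _ => ∅) (fun _ _ => 0) (fun _ _ => 0) (fun _ _ => 0) 0 := by
  refine ⟨fun _ _ => le_rfl, fun _ _ => le_rfl, fun _ _ => le_rfl, fun _ _ => by simp, le_rfl, ⟨_, _, gaugedTwoTierData_zero L N k W prof _⟩, ?_⟩
  have h0 : dirSq (fun (_ : Site d) (_ : Fin d) => (0 : Matrix n n ℂ)) (periodBox (d := d) (N * L ^ k)) = 0 := by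
    unfold dirSq; simp
  rw [h0]; simp

end

end Summit.QuantumFields.BalabanUV.T4Continuum.NE3GaugedTwoTierShape
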